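import Summits.Ventures.PercRepro.RankLevelSetLevelSevenT19Dev1
import Summits.Ventures.PercRepro.RankLevelSetLevelSevenT19Dev2
import Summits.Ventures.PercRepro.RankLevelSetLevelSevenT19Dev3
import Summits.Ventures.PercRepro.RankLevelSetLevelSevenT19Dev4
import Summits.Ventures.PercRepro.RankLevelSetLevelSevenT19Dev5
import Summits.Ventures.PercRepro.S4MidKeyNineteen
import Summits.Ventures.PercRepro.S4SevenWindow
import Summits.Ventures.PercRepro.RankLevelSetLevelSixRowsNineToFifteen

/-!
# PercRepro — THE 19 ROW OF LEVEL `7`: `c025_core_seven_nineteen (d ≥ 8) : RLS M 19 7` ON EVERY `e`-FREE CORE OF RANK `19`, AND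
**THEOREM C₇ AT RANK `19`** (p7 g25, S4 feeder; p8's assembly shape — NO window claim, p9 owns S4)

The core cells `(19, d)`: `8 ≤ d ≤ 76` by the coloop device with the lossy ladder (`c025_core_seven_nineteen_<d>`: `k` coloops reduce to the natural cell
`(19 − k, d)` of the row `19 − k` at the same corank, the rest retired — the generic device `c025_core_seven_of_cells_free` in RankLevelSetLevelSevenT19Dev1, RankLevelSetLevelSevenT19Dev2, RankLevelSetLevelSevenT19Dev3, RankLevelSetLevelSevenT19Dev4, RankLevelSetLevelSevenT19Dev5),
`d ≥ 77` by p1's middle key (`S4Mid.c025_core_seven_midkey_nineteen`, no coloop-freeness needed). Then the level-6 glue `rls_seven_at_of_core 19` on `c025_six_all`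
(level `6` at `p = 18`) gives level `7` at `p = 19`: **`c025_seven_at_nineteen : RLS M 19 7`** for every finite matroid.
Axioms: standard.
-/

open scoped Matroid

namespace PercRepro

namespace ThmN

variable {α : Type}

/-- **The core cell `(19, d)` at every corank `d ≥ 8`, every `e`-free core.** -/
theorem c025_core_seven_nineteen (M : Matroid α) [M.Finite] (d : ℕ) (hd8 : 8 ≤ d)
    (hR : M.eRank = (19 : ℕ∞)) (hn : M.E.ncard = 19 + d)
    (hfree : ∀ e ∈ M.E, ∃ A ⊆ M.E \ {e}, e ∉ M.closure A ∧ e ∉ M.closure ((M.E \ {e}) \ A)) :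
    RLS M 19 7 := by
  rcases Nat.lt_or_ge d 77 with hlt | hge
  · interval_cases d
    · exact c025_core_seven_nineteen_8 M hR hn hfree
    · exact c025_core_seven_nineteen_9 M hR hn hfree
    · exact c025_core_seven_nineteen_10 M hR hn hfree
    · exact c025_core_seven_nineteen_11 M hR hn hfree
    · exact c025_core_seven_nineteen_12 M hR hn hfree
    · exact c025_core_seven_nineteen_13 M hR hn hfree
    · exact c025_core_seven_nineteen_14 M hR hn hfree
    · exact c025_core_seven_nineteen_15 M hR hn hfree
    · exact c025_core_seven_nineteen_16 M hR hn hfree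
    · exact c025_core_seven_nineteen_17 M hR hn hfree
    · exact c025_core_seven_nineteen_18 M hR hn hfree
    · exact c025_core_seven_nineteen_19 M hR hn hfree
    · exact c025_core_seven_nineteen_20 M hR hn hfree
    · exact c025_core_seven_nineteen_21 M hR hn hfree
    · exact c025_core_seven_nineteen_22 M hR hn hfree
    · exact c025_core_seven_nineteen_23 M hR hn hfree
    · exact c025_core_seven_nineteen_24 M hR hn hfree
    · exact c025_core_seven_nineteen_25 M hR hn hfree
    · exact c025_core_seven_nineteen_26 M hR hn hfree
    · exact c025_core_seven_nineteen_27 M hR hn hfree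
    · exact c025_core_seven_nineteen_28 M hR hn hfree
    · exact c025_core_seven_nineteen_29 M hR hn hfree
    · exact c025_core_seven_nineteen_30 M hR hn hfree
    · exact c025_core_seven_nineteen_31 M hR hn hfree
    · exact c025_core_seven_nineteen_32 M hR hn hfree
    · exact c025_core_seven_nineteen_33 M hR hn hfree
    · exact c025_core_seven_nineteen_34 M hR hn hfree
    · exact c025_core_seven_nineteen_35 M hR hn hfree
    · exact c025_core_seven_nineteen_36 M hR hn hfree
    · exact c025_core_seven_nineteen_37 M hR hn hfree
    · exact c025_core_seven_nineteen_38 M hR hn hfree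
    · exact c025_core_seven_nineteen_39 M hR hn hfree
    · exact c025_core_seven_nineteen_40 M hR hn hfree
    · exact c025_core_seven_nineteen_41 M hR hn hfree
    · exact c025_core_seven_nineteen_42 M hR hn hfree
    · exact c025_core_seven_nineteen_43 M hR hn hfree
    · exact c025_core_seven_nineteen_44 M hR hn hfree
    · exact c025_core_seven_nineteen_45 M hR hn hfree
    · exact c025_core_seven_nineteen_46 M hR hn hfree
    · exact c025_core_seven_nineteen_47 M hR hn hfree
    · exact c025_core_seven_nineteen_48 M hR hn hfree
    · exact c025_core_seven_nineteen_49 M hR hn hfree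
    · exact c025_core_seven_nineteen_50 M hR hn hfree
    · exact c025_core_seven_nineteen_51 M hR hn hfree
    · exact c025_core_seven_nineteen_52 M hR hn hfree
    · exact c025_core_seven_nineteen_53 M hR hn hfree
    · exact c025_core_seven_nineteen_54 M hR hn hfree
    · exact c025_core_seven_nineteen_55 M hR hn hfree
    · exact c025_core_seven_nineteen_56 M hR hn hfree
    · exact c025_core_seven_nineteen_57 M hR hn hfree
    · exact c025_core_seven_nineteen_58 M hR hn hfree
    · exact c025_core_seven_nineteen_59 M hR hn hfree
    · exact c025_core_seven_nineteen_60 M hR hn hfree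
    · exact c025_core_seven_nineteen_61 M hR hn hfree
    · exact c025_core_seven_nineteen_62 M hR hn hfree
    · exact c025_core_seven_nineteen_63 M hR hn hfree
    · exact c025_core_seven_nineteen_64 M hR hn hfree
    · exact c025_core_seven_nineteen_65 M hR hn hfree
    · exact c025_core_seven_nineteen_66 M hR hn hfree
    · exact c025_core_seven_nineteen_67 M hR hn hfree
    · exact c025_core_seven_nineteen_68 M hR hn hfree
    · exact c025_core_seven_nineteen_69 M hR hn hfree
    · exact c025_core_seven_nineteen_70 M hR hn hfree
    · exact c025_core_seven_nineteen_71 M hR hn hfree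
    · exact c025_core_seven_nineteen_72 M hR hn hfree
    · exact c025_core_seven_nineteen_73 M hR hn hfree
    · exact c025_core_seven_nineteen_74 M hR hn hfree
    · exact c025_core_seven_nineteen_75 M hR hn hfree
    · exact c025_core_seven_nineteen_76 M hR hn hfree
  · exact S4Mid.c025_core_seven_midkey_nineteen M (by omega) hfree

/-- **THEOREM C₇ AT RANK `19`**: level `7` at `p = 19` for every finite matroid (on level `6` at `p = 18`, `c025_six_all`). -/
theorem c025_seven_at_nineteen (M : Matroid α) [M.Finite] : RLS M 19 7 :=
  rls_seven_at_of_core 19 (by norm_num) (fun M _ => c025_six_all M 18 (by norm_num))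
    (fun M _ d hd hR hn hfree => c025_core_seven_nineteen M d hd hR hn hfree) M

end ThmN

end PercRepro
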